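import Mathlib.Analysis.Calculus.BumpFunction.FiniteDimension
import Mathlib.Analysis.Calculus.InverseFunctionTheorem.ApproximatesLinearOn
import Mathlib.Analysis.Calculus.ContDiff.RCLike
import Mathlib.Analysis.SpecificLimits.Normed
import HarnessLib

/-!
# The point-pushing diffeomorphisms `y ↦ y + χ(y) • v`
(topic `Analysis/Calculus`; the elementary Euclidean construction behind "move a point by a
compactly supported diffeomorphism close to the identity": Hirsch 1976, *Differential Topology*,
Ch. 8, §3 (isotopies pushing points); Milnor 1965, *Topology from the Differentiable Viewpoint*,
§4, Homogeneity Lemma)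

For a real normed space `E`, a function `χ : E → ℝ` and a vector `v`, the **point push**
`pointPush χ v y = y + χ(y) • v` translates by `v` where `χ = 1` (a ball around a point) and is the
identity where `χ = 0` (off a larger ball). Main results, for `χ` Lipschitz with constant `L` and
`C¹` with `‖Dχ‖ ≤ L`:

* `contDiff_pointPush`, `hasFDerivAt_pointPush` (`D(pointPush) = id + Dχ ⊗ v`),
  `iteratedFDeriv_pointPush_sub_id` (all derivatives of `pointPush χ v − id` are those of `χ`
  tensored with `v`, of norm `≤ ‖Dʲχ‖ ‖v‖`).
* `approximatesLinearOn_pointPush`: `pointPush χ v` approximates the identity with constant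
  `L ‖v‖`; hence for `L ‖v‖ < 1` it is a HOMEOMORPHISM of `E` (`pointPushHomeomorph`, Mathlib's
  `ApproximatesLinearOn.toHomeomorph`) whose inverse is `Cⁿ` when `χ` is (`contDiff_pointPush_symm`,
  Mathlib's `Homeomorph.contDiff_symm`; the derivative `id + Dχ(y) ⊗ v` is a unit of the Banach
  algebra `E →L E` by the Neumann series, `Units.oneSub`).
* `pointPush_apply_of_eq_one/zero`: it moves the centre by `v` and fixes everything off the
  support of `χ`.

## References
* [Hirsch1976] M. W. Hirsch, *Differential Topology*, GTM 33, Springer 1976, Ch. 8, §3.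
* [Milnor1965] J. Milnor, *Topology from the Differentiable Viewpoint*, 1965, §4 (Homogeneity
  Lemma).
-/

noncomputable section

open Set Filter Topology Function Metric
open scoped NNReal ContDiff

namespace Literature.Analysis.Calculus

section PointPush

variable {E : Type*} [NormedAddCommGroup E] [NormedSpace ℝ E]

/-- The **point push** `y ↦ y + χ(y) • v`. [cite: Milnor1965, §4 Homogeneity Lemma] -/
def pointPush (χ : E → ℝ) (v : E) : E → E := fun y ↦ y + χ y • v

/-- Unfolding lemma. [folklore] -/
@[simp]
theorem pointPush_apply (χ : E → ℝ) (v y : E) : pointPush χ v y = y + χ y • v := rfl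

/-- Pushing by `0` is the identity. [folklore] -/
@[simp]
theorem pointPush_zero (χ : E → ℝ) : pointPush χ (0 : E) = id := by
  funext y; simp

/-- Where `χ = 1` the push is the translation by `v`. [folklore] -/
theorem pointPush_apply_of_eq_one {χ : E → ℝ} {y : E} (h : χ y = 1) (v : E) :
    pointPush χ v y = y + v := by
  simp [h]

/-- Where `χ = 0` the push is the identity. [folklore] -/
theorem pointPush_apply_of_eq_zero {χ : E → ℝ} {y : E} (h : χ y = 0) (v : E) :
    pointPush χ v y = y := by
  simp [h]

/-- `pointPush χ v − id = (χ ·) • v`. [folklore] -/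
theorem pointPush_sub_id (χ : E → ℝ) (v : E) : pointPush χ v - id = fun y ↦ χ y • v := by
  funext y; simp

/-- The push is as smooth as `χ`. [folklore] -/
theorem contDiff_pointPush {χ : E → ℝ} {n : ℕ∞ω} (hχ : ContDiff ℝ n χ) (v : E) :
    ContDiff ℝ n (pointPush χ v) :=
  contDiff_id.add (hχ.smul contDiff_const)

/-- The derivative of the push: `D(pointPush χ v)(y) = id + Dχ(y) ⊗ v`. [folklore] -/
theorem hasFDerivAt_pointPush {χ : E → ℝ} {χ' : E →L[ℝ] ℝ} {y : E} (hχ : HasFDerivAt χ χ' y)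
    (v : E) : HasFDerivAt (pointPush χ v) (ContinuousLinearMap.id ℝ E + χ'.smulRight v) y :=
  (hasFDerivAt_id y).add (hχ.smul_const v)

/-- The derivative of the push at a point of differentiability of `χ`. [folklore] -/
theorem fderiv_pointPush {χ : E → ℝ} {y : E} (hχ : DifferentiableAt ℝ χ y) (v : E) :
    fderiv ℝ (pointPush χ v) y = ContinuousLinearMap.id ℝ E + (fderiv ℝ χ y).smulRight v :=
  (hasFDerivAt_pointPush hχ.hasFDerivAt v).fderiv

/-- The size of the correction term: `‖Dχ(y) ⊗ v‖ ≤ ‖Dχ(y)‖ ‖v‖`. [folklore] -/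
theorem norm_smulRight_le (χ' : E →L[ℝ] ℝ) (v : E) : ‖χ'.smulRight v‖ ≤ ‖χ'‖ * ‖v‖ := by
  rw [ContinuousLinearMap.norm_smulRight_apply]

/-- **All derivatives of `pointPush χ v − id` are those of `χ` tensored with `v`**; in particular
`‖Dʲ(pointPush χ v − id)(y)‖ ≤ ‖Dʲχ(y)‖ · ‖v‖`. [folklore] -/
theorem norm_iteratedFDeriv_pointPush_sub_id_le {χ : E → ℝ} {n : ℕ∞ω} (hχ : ContDiff ℝ n χ)
    (v : E) {j : ℕ} (hj : (j : ℕ∞ω) ≤ n) (y : E) :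
    ‖iteratedFDeriv ℝ j (pointPush χ v - id) y‖ ≤ ‖iteratedFDeriv ℝ j χ y‖ * ‖v‖ := by
  rw [pointPush_sub_id]
  -- `y ↦ χ y • v` is `L ∘ χ` with `L t = t • v`
  set L : ℝ →L[ℝ] E := (ContinuousLinearMap.id ℝ ℝ).smulRight v with hL
  have hfun : (fun y ↦ χ y • v) = L ∘ χ := by funext y; simp [hL]
  rw [hfun, L.iteratedFDeriv_comp_left hχ.contDiffAt hj]
  have hLn : ‖L‖ ≤ ‖v‖ := by
    rw [hL, ContinuousLinearMap.norm_smulRight_apply]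
    exact mul_le_of_le_one_left (norm_nonneg v) ContinuousLinearMap.norm_id_le
  calc ‖L.compContinuousMultilinearMap (iteratedFDeriv ℝ j χ y)‖
      ≤ ‖L‖ * ‖iteratedFDeriv ℝ j χ y‖ := L.norm_compContinuousMultilinearMap_le _
    _ ≤ ‖v‖ * ‖iteratedFDeriv ℝ j χ y‖ := by gcongr
    _ = ‖iteratedFDeriv ℝ j χ y‖ * ‖v‖ := mul_comm _ _

/-- **The push approximates the identity**: for `χ` Lipschitz with constant `L`,
`pointPush χ v` approximates `id` on all of `E` with constant `L ‖v‖`. [folklore] -/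
theorem approximatesLinearOn_pointPush {χ : E → ℝ} {L : ℝ≥0} (hχ : LipschitzWith L χ) (v : E) :
    ApproximatesLinearOn (pointPush χ v)
      ((ContinuousLinearEquiv.refl ℝ E : E ≃L[ℝ] E) : E →L[ℝ] E) univ (L * ‖v‖₊) := by
  intro x _ y _
  have h : pointPush χ v x - pointPush χ v y -
      ((ContinuousLinearEquiv.refl ℝ E : E ≃L[ℝ] E) : E →L[ℝ] E) (x - y) = (χ x - χ y) • v := by
    rw [show ((ContinuousLinearEquiv.refl ℝ E : E ≃L[ℝ] E) : E →L[ℝ] E) (x - y) = x - y from rfl]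
    simp only [pointPush_apply, sub_smul]
    abel
  rw [h, norm_smul, NNReal.coe_mul, coe_nnnorm]
  have hL := hχ.dist_le_mul x y
  rw [dist_eq_norm, dist_eq_norm] at hL
  calc ‖χ x - χ y‖ * ‖v‖ ≤ L * ‖x - y‖ * ‖v‖ := by gcongr
    _ = L * ‖v‖ * ‖x - y‖ := by ring

variable [CompleteSpace E]

/-- **For `L ‖v‖ < 1` the push is a homeomorphism of `E`** (inverse function theorem in the global
form `ApproximatesLinearOn.toHomeomorph`). [cite: Hirsch1976, Ch. 8 §3] -/
def pointPushHomeomorph {χ : E → ℝ} {L : ℝ≥0} (hχ : LipschitzWith L χ) {v : E}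
    (hv : L * ‖v‖₊ < 1) : E ≃ₜ E :=
  (approximatesLinearOn_pointPush hχ v).toHomeomorph _ (by
    rcases subsingleton_or_nontrivial E with hE | hE
    · exact Or.inl hE
    · refine Or.inr ?_
      have h1 : ‖((ContinuousLinearEquiv.refl ℝ E).symm : E →L[ℝ] E)‖₊ = 1 := by
        rw [ContinuousLinearEquiv.refl_symm, ContinuousLinearEquiv.coe_refl, ← NNReal.coe_inj,
          coe_nnnorm, NNReal.coe_one]
        exact ContinuousLinearMap.norm_id
      rw [h1, inv_one]
      exact hv)

/-- The homeomorphism is the push. [folklore] -/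
@[simp]
theorem pointPushHomeomorph_coe {χ : E → ℝ} {L : ℝ≥0} (hχ : LipschitzWith L χ) {v : E}
    (hv : L * ‖v‖₊ < 1) : (pointPushHomeomorph hχ hv : E → E) = pointPush χ v := rfl

/-- The derivative of the push as a UNIT of the Banach algebra `E →L E` when
`‖Dχ(y)‖ ‖v‖ < 1` (Neumann series, `Units.oneSub`). [folklore] -/
def pointPushDerivEquiv (χ' : E →L[ℝ] ℝ) (v : E) (h : ‖χ'‖ * ‖v‖ < 1) : E ≃L[ℝ] E :=
  ContinuousLinearEquiv.unitsEquiv ℝ E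
    (Units.oneSub (-(χ'.smulRight v)) (by
      rw [norm_neg]; exact (norm_smulRight_le χ' v).trans_lt h))

/-- The unit is `id + Dχ(y) ⊗ v`. [folklore] -/
theorem pointPushDerivEquiv_coe (χ' : E →L[ℝ] ℝ) (v : E) (h : ‖χ'‖ * ‖v‖ < 1) :
    (pointPushDerivEquiv χ' v h : E →L[ℝ] E) = ContinuousLinearMap.id ℝ E + χ'.smulRight v := by
  ext x
  simp [pointPushDerivEquiv, Units.val_oneSub]

/-- **The inverse of the push is smooth**: for `χ` of class `Cⁿ` (`n ≥ 1`), Lipschitz with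
constant `L`, with `‖Dχ‖ ≤ L` everywhere and `L ‖v‖ < 1`, the inverse of `pointPushHomeomorph`
is `Cⁿ` (Mathlib `Homeomorph.contDiff_symm`, the derivative being everywhere a unit).
[cite: Hirsch1976, Ch. 8 §3] -/
theorem contDiff_pointPush_symm {χ : E → ℝ} {n : ℕ∞ω} (hn : n ≠ 0) (hχ : ContDiff ℝ n χ)
    {L : ℝ≥0} (hχL : LipschitzWith L χ) (hDχ : ∀ y, ‖fderiv ℝ χ y‖ ≤ L) {v : E}
    (hv : L * ‖v‖₊ < 1) : ContDiff ℝ n ((pointPushHomeomorph hχL hv).symm : E → E) := by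
  have hbound : ∀ y, ‖fderiv ℝ χ y‖ * ‖v‖ < 1 := fun y ↦ by
    have h1 : (L : ℝ) * ‖v‖ < 1 := by
      have := hv; rwa [← NNReal.coe_lt_coe, NNReal.coe_mul, coe_nnnorm] at this
    exact (mul_le_mul_of_nonneg_right (hDχ y) (norm_nonneg v)).trans_lt h1
  refine (pointPushHomeomorph hχL hv).contDiff_symm
    (f₀' := fun y ↦ pointPushDerivEquiv (fderiv ℝ χ y) v (hbound y)) (fun y ↦ ?_)
    (by simpa using contDiff_pointPush hχ v)
  rw [pointPushDerivEquiv_coe, pointPushHomeomorph_coe]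
  exact hasFDerivAt_pointPush ((hχ.differentiable hn y).hasFDerivAt) v

/-- The inverse undoes the push. [folklore] -/
theorem pointPushHomeomorph_symm_apply_pointPush {χ : E → ℝ} {L : ℝ≥0} (hχ : LipschitzWith L χ)
    {v : E} (hv : L * ‖v‖₊ < 1) (y : E) :
    (pointPushHomeomorph hχ hv).symm (pointPush χ v y) = y :=
  (pointPushHomeomorph hχ hv).symm_apply_apply y

/-- The push undoes the inverse. [folklore] -/
theorem pointPush_pointPushHomeomorph_symm_apply {χ : E → ℝ} {L : ℝ≥0} (hχ : LipschitzWith L χ)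
    {v : E} (hv : L * ‖v‖₊ < 1) (y : E) :
    pointPush χ v ((pointPushHomeomorph hχ hv).symm y) = y :=
  (pointPushHomeomorph hχ hv).apply_symm_apply y

/-- Off the support of `χ` the inverse is the identity as well. [folklore] -/
theorem pointPushHomeomorph_symm_apply_of_eq_zero {χ : E → ℝ} {L : ℝ≥0} (hχ : LipschitzWith L χ)
    {v : E} (hv : L * ‖v‖₊ < 1) {y : E} (h : χ y = 0) :
    (pointPushHomeomorph hχ hv).symm y = y := by
  conv_lhs => rw [← pointPush_apply_of_eq_zero h v]
  exact pointPushHomeomorph_symm_apply_pointPush hχ hv y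

end PointPush

/-! ### Bumps: a standard smooth `χ` and its Lipschitz constant -/

section Bump

variable {E : Type*} [NormedAddCommGroup E] [NormedSpace ℝ E] [FiniteDimensional ℝ E]

/-- **A smooth bump has a global Lipschitz / derivative bound**: for a `ContDiffBump` `χ` centred at
`c` there is `L ≥ 0` with `χ` Lipschitz with constant `L` and `‖Dχ‖ ≤ L` everywhere (compact
support and continuity of `Dχ`). [folklore] -/
theorem exists_lipschitz_bound_bump {c : E} (χ : ContDiffBump c) :
    ∃ L : ℝ≥0, LipschitzWith L χ ∧ ∀ y, ‖fderiv ℝ (χ : E → ℝ) y‖ ≤ L := by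
  have hcs : HasCompactSupport (fderiv ℝ (χ : E → ℝ)) := χ.hasCompactSupport.fderiv ℝ
  have hcont : Continuous (fderiv ℝ (χ : E → ℝ)) :=
    (χ.contDiff (n := 1)).continuous_fderiv one_ne_zero
  obtain ⟨C, hC⟩ := hcs.exists_bound_of_continuous hcont
  refine ⟨⟨max C 0, le_max_right _ _⟩, ?_, fun y ↦ (hC y).trans (le_max_left _ _)⟩
  refine lipschitzWith_of_nnnorm_fderiv_le ((χ.contDiff (n := 1)).differentiable one_ne_zero)
    fun y ↦ ?_
  rw [← NNReal.coe_le_coe, coe_nnnorm]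
  exact (hC y).trans (le_max_left _ _)

end Bump

end Literature.Analysis.Calculus
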